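import Literature.NumberTheory.Automorphic.HeckeEulerFactorisationGL2
import Literature.NumberTheory.Automorphic.ArchHeckeTestVectorGL2
import HarnessLib

/-!
# The standard `L`-theory of `GL₂`, the Galois-twisted Hecke theory and Gelbart's Prop. 4.1 from the
# NAMED archimedean fact `JacquetLanglands1970_archHeckeTestVectorGL2` (Jacquet–Langlands 1970, Thm. 11.1)

Topic `Literature/NumberTheory/Automorphic`. Theorems only (no definition, no named fact, no instance).

The named fact `JacquetLanglands1970_archHeckeTestVectorGL2` (`ArchHeckeTestVectorGL2.lean`: the
archimedean two-sided Hecke test vector of Jacquet–Langlands (1970), Thm. 5.15 (ii)(iii) / Thm. 6.4, in the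
form used on p. 173) is, character for character, the hypothesis `hA` of the ACCEPTED entry points
`JacquetLanglands1970_standardLTheoryGL2_of_archHeckeTestVector`,
`frobSatakeCompatibleAt_of_isPiOfArtinRep_of_isUnramifiedAt_of_archHeckeTestVector` and
`JacquetLanglands1970_twistedHeckeTheoryGL2_and_frobSatakeCompatibleAt_of_archHeckeTestVector`
(`HeckeEulerFactorisationGL2.lean`, where the Euler factorisation `(E′)` of the global Hecke integral is the
theorem `heckeEulerFactorisationGL2`). This file records the resulting BY-NAME reductions: each of the
three named facts

* `JacquetLanglands1970_standardLTheoryGL2` (Jacquet–Langlands (1970), Thm. 11.1: the standard `L`-theory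
  of cuspidal `GL₂` with honest local factors at all places),
* `JacquetLanglands1970_twistedHeckeTheoryGL2` (ibid., Thm. 11.1 / Cor. 11.2: the Galois-twisted Hecke
  theory) together with its companion `frobSatakeCompatibleAt_of_isPiOfArtinRep`,
* `frobSatakeCompatibleAt_of_isPiOfArtinRep_of_isUnramifiedAt` (Gelbart (1997), Prop. 4.1 at the
  `σ`-unramified places),

follows from `JacquetLanglands1970_archHeckeTestVectorGL2` alone, so that a discharge
`JacquetLanglands1970_archHeckeTestVectorGL2_holds` closes all of them by one-line proofs.

## References

* H. Jacquet, R. P. Langlands, *Automorphic Forms on GL(2)*, Lecture Notes in Math. 114, Springer (1970):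
  Thm. 5.15, Thm. 6.4, Thm. 11.1, Cor. 11.2 (proof of Thm. 11.1, pp. 171–173). [JacquetLanglands1970]
* S. Gelbart, *Three lectures on the modularity of ρ̄_{E,3} and the Langlands reciprocity conjecture*, in
  Modular Forms and Fermat's Last Theorem, Springer (1997), Prop. 4.1. [Gelbart1997]
-/

noncomputable section

namespace Literature.NumberTheory.Automorphic

/-- **Jacquet–Langlands (1970), Thm. 11.1 from the named archimedean fact**: the standard `L`-theory of
cuspidal `GL₂` (`JacquetLanglands1970_standardLTheoryGL2`) follows from the archimedean two-sided Hecke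
test vector `JacquetLanglands1970_archHeckeTestVectorGL2` (by
`JacquetLanglands1970_standardLTheoryGL2_of_archHeckeTestVector`, whose hypothesis it is verbatim).
[cite: JacquetLanglands1970, Thm. 11.1, Thm. 5.15 (ii)(iii), Thm. 6.4] -/
theorem JacquetLanglands1970_standardLTheoryGL2_of_JacquetLanglands1970_archHeckeTestVectorGL2
    (hA : JacquetLanglands1970_archHeckeTestVectorGL2) : JacquetLanglands1970_standardLTheoryGL2 :=
  JacquetLanglands1970_standardLTheoryGL2_of_archHeckeTestVector hA

/-- **Gelbart (1997), Prop. 4.1 at the `σ`-unramified places from the named archimedean fact**: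
`frobSatakeCompatibleAt_of_isPiOfArtinRep_of_isUnramifiedAt` follows from
`JacquetLanglands1970_archHeckeTestVectorGL2` (by
`frobSatakeCompatibleAt_of_isPiOfArtinRep_of_isUnramifiedAt_of_archHeckeTestVector`).
[cite: Gelbart1997, Prop. 4.1] [cite: JacquetLanglands1970, Thm. 12.2, Thm. 11.1, Thm. 5.15, Thm. 6.4] -/
theorem frobSatakeCompatibleAt_of_isPiOfArtinRep_of_isUnramifiedAt_of_JacquetLanglands1970_archHeckeTestVectorGL2
    (hA : JacquetLanglands1970_archHeckeTestVectorGL2) :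
    frobSatakeCompatibleAt_of_isPiOfArtinRep_of_isUnramifiedAt :=
  frobSatakeCompatibleAt_of_isPiOfArtinRep_of_isUnramifiedAt_of_archHeckeTestVector hA

/-- **Jacquet–Langlands (1970), Thm. 11.1 / Cor. 11.2 (Galois-twisted Hecke theory) and the
`π`-unramified companion of Gelbart's Prop. 4.1 from the named archimedean fact** (by
`JacquetLanglands1970_twistedHeckeTheoryGL2_and_frobSatakeCompatibleAt_of_archHeckeTestVector`, whose
hypothesis is `JacquetLanglands1970_archHeckeTestVectorGL2` unfolded; this by-name form is the one to
thread `(hA : JacquetLanglands1970_archHeckeTestVectorGL2)` through — dedup-03065: intentional wrapper,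
not an independent result).
[cite: JacquetLanglands1970, Thm. 11.1, Cor. 11.2, Thm. 5.15, Thm. 6.4] [cite: Gelbart1997, Prop. 4.1] -/
theorem JacquetLanglands1970_twistedHeckeTheoryGL2_and_frobSatakeCompatibleAt_of_JacquetLanglands1970_archHeckeTestVectorGL2
    (hA : JacquetLanglands1970_archHeckeTestVectorGL2) :
    JacquetLanglands1970_twistedHeckeTheoryGL2 ∧ frobSatakeCompatibleAt_of_isPiOfArtinRep :=
  JacquetLanglands1970_twistedHeckeTheoryGL2_and_frobSatakeCompatibleAt_of_archHeckeTestVector hA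

/-- **Jacquet–Langlands (1970), Thm. 11.1 / Cor. 11.2 from the named archimedean fact**: the
Galois-twisted Hecke theory `JacquetLanglands1970_twistedHeckeTheoryGL2` (first component of
`JacquetLanglands1970_twistedHeckeTheoryGL2_and_frobSatakeCompatibleAt_of_archHeckeTestVector`).
[cite: JacquetLanglands1970, Thm. 11.1, Cor. 11.2, Thm. 5.15, Thm. 6.4] -/
theorem JacquetLanglands1970_twistedHeckeTheoryGL2_of_JacquetLanglands1970_archHeckeTestVectorGL2
    (hA : JacquetLanglands1970_archHeckeTestVectorGL2) : JacquetLanglands1970_twistedHeckeTheoryGL2 :=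
  (JacquetLanglands1970_twistedHeckeTheoryGL2_and_frobSatakeCompatibleAt_of_archHeckeTestVector hA).1

end Literature.NumberTheory.Automorphic
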